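import Literature.NumberTheory.EllipticCurves.RationalIsogenyFrobeniusCriterion
import Literature.NumberTheory.EllipticCurves.RationalIsogenyFrobeniusCertificates11
import HarnessLib

/-!
# Crux `MazurKenkuBound` (stmt-ABC-15125), line `Sketch` — stub `stub_certEleven`:
# no rational `7`- or `13`-isogeny out of the `j`-table of `X₀(11)`

Kenku 1982, proof of Thm. 1, case (c), at the levels `7·11` and `13·11`: a cyclic `ℚ`-isogeny of
degree `77` or `143` would give, out of one elliptic curve over `ℚ`, a rational `11`-isogeny — so
`j ∈ {-11², -11·131³, -2¹⁵}`, the table of `X₀(11)` — and a rational `7`- resp. `13`-isogeny. The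
latter is refuted, `j` by `j`, by a Frobenius certificate (Mazur 1978, Prop. 6.3 (1)): for the
globally minimal integer model `E₀` with that `j` and a good prime `ℓ`, `X² − a_ℓX + ℓ` must have
a root modulo the isogeny degree `q`, and it has none modulo `7` and `13`.

All the arithmetic is in the landed criterion
`Literature.NumberTheory.EllipticCurves.j_ne_of_isogeny_prime_degree_of_certificate'`
(`RationalIsogenyFrobeniusCriterion.lean`) and the kernel-decided point counts
`KenkuLevelsCert.card_E11_*` (`RationalIsogenyFrobeniusCertificates11.lean`); this file only feeds
them the three rows of data:

* `j = -121`: `E₀ = [1, 1, 0, -2, -7]`, `Δ = -11⁴`, `ℓ = 3`, `#Ẽ₀(𝔽₃) = 2` (`a₃ = 2`);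
* `j = -24729001`: `E₀ = [1, 1, 1, -30, -76]`, `Δ = -11²`, `ℓ = 3`, `#Ẽ₀(𝔽₃) = 2` (`a₃ = 2`);
* `j = -32768`: `E₀ = [0, -1, 1, -7, 10]`, `Δ = -11³`, `ℓ = 2`, `#Ẽ₀(𝔽₂) = 3` (`a₂ = 0`);

`X² − 2X + 3` and `X² + 2` are root-free modulo `7` and modulo `13` (`decide`).

## References

* [Mazur1978] B. Mazur, *Rational isogenies of prime degree*, Invent. Math. 44 (1978) 129–162,
  §6 Prop. 6.3 (1) (p. 153), Thm. 1 and the table p. 129 (`X₀(11)`).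
* [Kenku1982] M. A. Kenku, *On the number of ℚ-isomorphism classes of elliptic curves in each
  ℚ-isogeny class*, J. Number Theory 15 (1982) 199–202, proof of Thm. 1, case (c), p. 201.
-/

-- `Summit.ABC.ABC` is the mandated summit-side namespace (CONVENTIONS §2); the duplicate is deliberate.
set_option linter.dupNamespace false

noncomputable section

open scoped Classical
open WeierstrassCurve
open Literature.NumberTheory.EllipticCurves

namespace Summit.ABC.ABC.Theorems

/-- No `ℚ`-isogeny of degree `7` or `13` out of an elliptic curve over `ℚ` with `j = -121 = -11²`
(model `[1, 1, 0, -2, -7]`, `Δ = -11⁴`, witness prime `ℓ = 3`, `a₃ = 2`: `X² − 2X + 3` has no root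
modulo `7` or `13`). [cite: Mazur1978, §6 Prop. 6.3 (1) (p. 153)]
[cite: Kenku1982, proof of Thm. 1, case (c), p. 201] -/
private theorem j_ne_jm121 {W W' : WeierstrassCurve ℚ} [W.IsElliptic] [W'.IsElliptic]
    (ψ : Isogeny W W') (hq : ψ.degree = 7 ∨ ψ.degree = 13) : W.j ≠ -121 := by
  have hj : (((⟨1, 1, 0, -2, -7⟩ : WeierstrassCurve ℤ)).c₄ : ℚ) ^ 3 /
      (((⟨1, 1, 0, -2, -7⟩ : WeierstrassCurve ℤ)).Δ : ℚ) = -121 := by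
    norm_num [WeierstrassCurve.Δ, WeierstrassCurve.c₄, WeierstrassCurve.b₂, WeierstrassCurve.b₄,
      WeierstrassCurve.b₆, WeierstrassCurve.b₈]
  -- the two root-freeness certificates, decided BEFORE any local `Fact` instance is introduced
  -- (a local `Fact (Nat.Prime q)` would be picked up by `Fintype (ZMod q)` and block `decide`)
  have hnr7 : ∀ t : ZMod 7,
      t ^ 2 - (((3 : ℕ) : ℤ) + 1 - (2 : ℕ) : ℤ) * t + ((3 : ℕ) : ZMod 7) ≠ 0 := by
    decide +kernel
  have hnr13 : ∀ t : ZMod 13,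
      t ^ 2 - (((3 : ℕ) : ℤ) + 1 - (2 : ℕ) : ℤ) * t + ((3 : ℕ) : ZMod 13) ≠ 0 := by
    decide +kernel
  rw [← hj]
  haveI : Fact (Nat.Prime 3) := ⟨by norm_num⟩
  rcases hq with hq | hq
  · haveI : Fact (Nat.Prime 7) := ⟨by norm_num⟩
    exact j_ne_of_isogeny_prime_degree_of_certificate' _ (B := 3) (by decide +kernel)
      (by decide +kernel) (by decide +kernel) (by decide +kernel) (ℓ := 3) (by decide +kernel)
      KenkuLevelsCert.card_E11_jm121_3 (q := 7) (by norm_num) hnr7 ψ hq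
  · haveI : Fact (Nat.Prime 13) := ⟨by norm_num⟩
    exact j_ne_of_isogeny_prime_degree_of_certificate' _ (B := 3) (by decide +kernel)
      (by decide +kernel) (by decide +kernel) (by decide +kernel) (ℓ := 3) (by decide +kernel)
      KenkuLevelsCert.card_E11_jm121_3 (q := 13) (by norm_num) hnr13 ψ hq

/-- No `ℚ`-isogeny of degree `7` or `13` out of an elliptic curve over `ℚ` with
`j = -24729001 = -11·131³` (model `[1, 1, 1, -30, -76]`, `Δ = -11²`, witness prime `ℓ = 3`,
`a₃ = 2`: `X² − 2X + 3` has no root modulo `7` or `13`). [cite: Mazur1978, §6 Prop. 6.3 (1) (p. 153)]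
[cite: Kenku1982, proof of Thm. 1, case (c), p. 201] -/
private theorem j_ne_jm24729001 {W W' : WeierstrassCurve ℚ} [W.IsElliptic] [W'.IsElliptic]
    (ψ : Isogeny W W') (hq : ψ.degree = 7 ∨ ψ.degree = 13) : W.j ≠ -24729001 := by
  have hj : (((⟨1, 1, 1, -30, -76⟩ : WeierstrassCurve ℤ)).c₄ : ℚ) ^ 3 /
      (((⟨1, 1, 1, -30, -76⟩ : WeierstrassCurve ℤ)).Δ : ℚ) = -24729001 := by
    norm_num [WeierstrassCurve.Δ, WeierstrassCurve.c₄, WeierstrassCurve.b₂, WeierstrassCurve.b₄,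
      WeierstrassCurve.b₆, WeierstrassCurve.b₈]
  have hnr7 : ∀ t : ZMod 7,
      t ^ 2 - (((3 : ℕ) : ℤ) + 1 - (2 : ℕ) : ℤ) * t + ((3 : ℕ) : ZMod 7) ≠ 0 := by
    decide +kernel
  have hnr13 : ∀ t : ZMod 13,
      t ^ 2 - (((3 : ℕ) : ℤ) + 1 - (2 : ℕ) : ℤ) * t + ((3 : ℕ) : ZMod 13) ≠ 0 := by
    decide +kernel
  rw [← hj]
  haveI : Fact (Nat.Prime 3) := ⟨by norm_num⟩
  rcases hq with hq | hq
  · haveI : Fact (Nat.Prime 7) := ⟨by norm_num⟩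
    exact j_ne_of_isogeny_prime_degree_of_certificate' _ (B := 2) (by decide +kernel)
      (by decide +kernel) (by decide +kernel) (by decide +kernel) (ℓ := 3) (by decide +kernel)
      KenkuLevelsCert.card_E11_jm24729001_3 (q := 7) (by norm_num) hnr7 ψ hq
  · haveI : Fact (Nat.Prime 13) := ⟨by norm_num⟩
    exact j_ne_of_isogeny_prime_degree_of_certificate' _ (B := 2) (by decide +kernel)
      (by decide +kernel) (by decide +kernel) (by decide +kernel) (ℓ := 3) (by decide +kernel)
      KenkuLevelsCert.card_E11_jm24729001_3 (q := 13) (by norm_num) hnr13 ψ hq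

/-- No `ℚ`-isogeny of degree `7` or `13` out of an elliptic curve over `ℚ` with `j = -32768 = -2¹⁵`
(CM by `-11`; model `[0, -1, 1, -7, 10]`, `Δ = -11³`, witness prime `ℓ = 2`, `a₂ = 0`: `X² + 2` has
no root modulo `7` or `13`). [cite: Mazur1978, §6 Prop. 6.3 (1) (p. 153)]
[cite: Kenku1982, proof of Thm. 1, case (c), p. 201] -/
private theorem j_ne_jm32768 {W W' : WeierstrassCurve ℚ} [W.IsElliptic] [W'.IsElliptic]
    (ψ : Isogeny W W') (hq : ψ.degree = 7 ∨ ψ.degree = 13) : W.j ≠ -32768 := by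
  have hj : (((⟨0, -1, 1, -7, 10⟩ : WeierstrassCurve ℤ)).c₄ : ℚ) ^ 3 /
      (((⟨0, -1, 1, -7, 10⟩ : WeierstrassCurve ℤ)).Δ : ℚ) = -32768 := by
    norm_num [WeierstrassCurve.Δ, WeierstrassCurve.c₄, WeierstrassCurve.b₂, WeierstrassCurve.b₄,
      WeierstrassCurve.b₆, WeierstrassCurve.b₈]
  have hnr7 : ∀ t : ZMod 7,
      t ^ 2 - (((2 : ℕ) : ℤ) + 1 - (3 : ℕ) : ℤ) * t + ((2 : ℕ) : ZMod 7) ≠ 0 := by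
    decide +kernel
  have hnr13 : ∀ t : ZMod 13,
      t ^ 2 - (((2 : ℕ) : ℤ) + 1 - (3 : ℕ) : ℤ) * t + ((2 : ℕ) : ZMod 13) ≠ 0 := by
    decide +kernel
  rw [← hj]
  haveI : Fact (Nat.Prime 2) := ⟨by norm_num⟩
  rcases hq with hq | hq
  · haveI : Fact (Nat.Prime 7) := ⟨by norm_num⟩
    exact j_ne_of_isogeny_prime_degree_of_certificate' _ (B := 2) (by decide +kernel)
      (by decide +kernel) (by decide +kernel) (by decide +kernel) (ℓ := 2) (by decide +kernel)
      KenkuLevelsCert.card_E11_jm32768_2 (q := 7) (by norm_num) hnr7 ψ hq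
  · haveI : Fact (Nat.Prime 13) := ⟨by norm_num⟩
    exact j_ne_of_isogeny_prime_degree_of_certificate' _ (B := 2) (by decide +kernel)
      (by decide +kernel) (by decide +kernel) (by decide +kernel) (ℓ := 2) (by decide +kernel)
      KenkuLevelsCert.card_E11_jm32768_2 (q := 13) (by norm_num) hnr13 ψ hq

/-- **Kenku 1982, case (c), levels `77 = 7·11` and `143 = 13·11`, per `j`.** No elliptic curve over
`ℚ` whose `j`-invariant lies in the table of `X₀(11)`, `j ∈ {-11², -11·131³, -2¹⁵}`, admits a
`ℚ`-isogeny of degree `7` or `13`: by Mazur 1978, Prop. 6.3 (1), such an isogeny out of the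
globally minimal models `[1,1,0,-2,-7]`, `[1,1,1,-30,-76]`, `[0,-1,1,-7,10]` would force a root of
`X² − a_ℓX + ℓ` modulo `7` resp. `13` at the good primes `ℓ = 3, 3, 2` (`a₃ = 2, 2`, `a₂ = 0`), and
there is none. [cite: Mazur1978, §6 Prop. 6.3 (1) (p. 153)]
[cite: Kenku1982, proof of Thm. 1, case (c), p. 201] -/
theorem stub_certEleven :
    ∀ (W W' : WeierstrassCurve ℚ) [W.IsElliptic] [W'.IsElliptic] (ψ : Isogeny W W'),
      (ψ.degree = 7 ∨ ψ.degree = 13) → W.j ∉ ({-121, -24729001, -32768} : Finset ℚ) := by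
  intro W W' _ _ ψ hq hmem
  simp only [Finset.mem_insert, Finset.mem_singleton] at hmem
  rcases hmem with h | h | h
  · exact j_ne_jm121 ψ hq h
  · exact j_ne_jm24729001 ψ hq h
  · exact j_ne_jm32768 ψ hq h

end Summit.ABC.ABC.Theorems

end
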